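import Mathlib
import Literature.Geometry.Symplectic.SteinBall

/-!
# `HyperbolicEnd` (stmt-SmoothPoincare4-7825), line `Sketch`, negative side — the exponential `J₀`-curve

Helper for the negative side of the line `Sketch` (`Theorems/HyperbolicEnd/Negative/`, native
frozen-`J` refutation on `ℝ⁴ = ℂ²` with `J = J₀ = stdComplexStructure`); statement registered on
the crux item (stub helper_frozen_expCurve).  The refutation of the flat filling stub pulls a
filled density back along the `J₀`-holomorphic curve
`G(w) = "exp w in the first complex coordinate line" = (re eʷ, im eʷ, 0, 0) ∈ ℝ⁴`, i.e.
`G w = (re eʷ) e₀ + (im eʷ) J₀ e₀` with `e₀ = (1, 0, 0, 0)`; this file collects the elementary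
facts about `G`:

1. `G` is `C^∞`;
2. `G` is `J₀`-holomorphic: `DG_w (iζ) = J₀ (DG_w ζ)`;
3. `∂ₓ G = DG_w 1 = G w`;
4. `‖G w‖ = e^{re w}`;
5. coordinates: `(G w)₀² + (G w)₁² = e^{2 re w}`, `(G w)₂ = (G w)₃ = 0`;
6. `G` is `2πi`-periodic.

*Proof.* `G = L ∘ exp` with the real-linear map `L ζ = (re ζ) e₀ + (im ζ) J₀ e₀`, so by the chain
rule `DG_w ζ = L (eʷ ζ)` (`D exp_w ζ = eʷ ζ`); `L (iξ) = -(im ξ) e₀ + (re ξ) J₀ e₀ = J₀ (L ξ)`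
since `J₀² = -1`, whence (2) with `ξ = eʷ ζ`, and (3) with `ζ = 1`.  For (4), `e₀ ⊥ J₀ e₀` and
`‖J₀ e₀‖ = ‖e₀‖ = 1` give `‖a e₀ + b J₀ e₀‖² = a² + b²`, and `(re eʷ)² + (im eʷ)² = |eʷ|² = e^{2 re w}`;
(5) is read off the coordinates `J₀ e₀ = (0, 1, 0, 0)`; (6) is the periodicity of `exp`.
-/

noncomputable section

-- the prescribed namespace `Summit.<P>.<Sub>.…` duplicates `SmoothPoincare4` (P = Sub)
set_option linter.dupNamespace false

open scoped ContDiff Topology Real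
open Laplacian Set Filter Metric Complex
open Literature.Geometry.Symplectic

namespace Summit.SmoothPoincare4.SmoothPoincare4.Theorems.HyperbolicEnd.Negative

/-! ### Linear algebra of `J₀` -/

/-- `J₀` is an isometry of `ℝ⁴`: `‖J₀ v‖ = ‖v‖`. -/
private theorem expCurve_norm_stdComplexStructure (v : EuclideanSpace ℝ (Fin 4)) :
    ‖stdComplexStructure v‖ = ‖v‖ := by
  have h : ‖stdComplexStructure v‖ ^ 2 = ‖v‖ ^ 2 := by
    rw [← real_inner_self_eq_norm_sq, ← real_inner_self_eq_norm_sq,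
      inner_stdComplexStructure_stdComplexStructure]
  exact (sq_eq_sq₀ (norm_nonneg _) (norm_nonneg _)).1 h

/-- `‖a v + b J₀ v‖² = (a² + b²) ‖v‖²`, since `v ⊥ J₀ v` and `‖J₀ v‖ = ‖v‖`. -/
private theorem expCurve_norm_sq_smul_add_smul (v : EuclideanSpace ℝ (Fin 4)) (a b : ℝ) :
    ‖a • v + b • stdComplexStructure v‖ ^ 2 = (a ^ 2 + b ^ 2) * ‖v‖ ^ 2 := by
  rw [norm_add_sq_real, real_inner_smul_left, real_inner_smul_right,
    inner_stdComplexStructure_self, norm_smul, norm_smul, expCurve_norm_stdComplexStructure,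
    Real.norm_eq_abs, Real.norm_eq_abs, mul_pow, mul_pow, sq_abs, sq_abs]
  ring

/-- The real-linear line map `L ξ = (re ξ) v + (im ξ) J₀ v` intertwines `i` and `J₀`:
`L (iξ) = J₀ (L ξ)`. -/
private theorem expCurve_line_I_mul (v : EuclideanSpace ℝ (Fin 4)) (ξ : ℂ) :
    (Complex.I * ξ).re • v + (Complex.I * ξ).im • stdComplexStructure v =
      stdComplexStructure (ξ.re • v + ξ.im • stdComplexStructure v) := by
  simp only [Complex.I_mul_re, Complex.I_mul_im, map_add, map_smul, stdComplexStructure_sq,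
    smul_neg, neg_smul]
  abel

/-! ### Calculus of the exponential line `w ↦ (re eʷ) v + (im eʷ) J₀ v` -/

/-- The real Fréchet derivative of `exp : ℂ → ℂ` is multiplication by `exp w`. -/
private theorem expCurve_fderiv_cexp (w ζ : ℂ) :
    fderiv ℝ Complex.exp w ζ = Complex.exp w * ζ := by
  rw [(Complex.hasStrictFDerivAt_exp_real w).hasFDerivAt.fderiv]
  simp

/-- The exponential line in direction `v` factors as `L ∘ exp` through a real-linear map
`L ζ = (re ζ) v + (im ζ) J₀ v`. -/
private theorem expCurve_exists_clm (v : EuclideanSpace ℝ (Fin 4)) :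
    ∃ L : ℂ →L[ℝ] EuclideanSpace ℝ (Fin 4),
      ∀ ζ : ℂ, L ζ = ζ.re • v + ζ.im • stdComplexStructure v :=
  ⟨Complex.reCLM.smulRight v + Complex.imCLM.smulRight (stdComplexStructure v),
    fun ζ => by simp⟩

/-- The exponential line in direction `v` is `C^∞`. -/
private theorem expCurve_contDiff (v : EuclideanSpace ℝ (Fin 4)) :
    ContDiff ℝ ∞ (fun w : ℂ => (Complex.exp w).re • v +
      (Complex.exp w).im • stdComplexStructure v) := by
  obtain ⟨L, hL⟩ := expCurve_exists_clm v
  have hfun : (fun w : ℂ => (Complex.exp w).re • v +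
      (Complex.exp w).im • stdComplexStructure v) = fun w : ℂ => L (Complex.exp w) :=
    funext fun w => (hL (Complex.exp w)).symm
  rw [hfun]
  exact L.contDiff.comp (Complex.contDiff_exp (𝕜 := ℝ))

/-- The differential of the exponential line in direction `v`:
`D_w ζ = (re (eʷζ)) v + (im (eʷζ)) J₀ v`. -/
private theorem expCurve_fderiv (v : EuclideanSpace ℝ (Fin 4)) (w ζ : ℂ) :
    fderiv ℝ (fun w : ℂ => (Complex.exp w).re • v +
      (Complex.exp w).im • stdComplexStructure v) w ζ =
      (Complex.exp w * ζ).re • v + (Complex.exp w * ζ).im • stdComplexStructure v := by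
  obtain ⟨L, hL⟩ := expCurve_exists_clm v
  have hfun : (fun w : ℂ => (Complex.exp w).re • v +
      (Complex.exp w).im • stdComplexStructure v) = fun w : ℂ => L (Complex.exp w) :=
    funext fun w => (hL (Complex.exp w)).symm
  have hd : HasFDerivAt (fun w : ℂ => L (Complex.exp w))
      (L.comp (fderiv ℝ Complex.exp w)) w :=
    L.hasFDerivAt.comp w (Complex.differentiableAt_exp (𝕜 := ℝ)).hasFDerivAt
  rw [hfun, hd.fderiv, ContinuousLinearMap.comp_apply, expCurve_fderiv_cexp, hL]

/-! ### Coordinates of the first complex line -/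

/-- Coordinates of `a e₀ + b J₀ e₀ = (a, b, 0, 0)`. -/
private theorem expCurve_coords (a b : ℝ) :
    (a • EuclideanSpace.single (0 : Fin 4) (1 : ℝ) +
        b • stdComplexStructure (EuclideanSpace.single (0 : Fin 4) (1 : ℝ))) 0 = a ∧
    (a • EuclideanSpace.single (0 : Fin 4) (1 : ℝ) +
        b • stdComplexStructure (EuclideanSpace.single (0 : Fin 4) (1 : ℝ))) 1 = b ∧
    (a • EuclideanSpace.single (0 : Fin 4) (1 : ℝ) +
        b • stdComplexStructure (EuclideanSpace.single (0 : Fin 4) (1 : ℝ))) 2 = 0 ∧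
    (a • EuclideanSpace.single (0 : Fin 4) (1 : ℝ) +
        b • stdComplexStructure (EuclideanSpace.single (0 : Fin 4) (1 : ℝ))) 3 = 0 := by
  refine ⟨?_, ?_, ?_, ?_⟩ <;> simp

/-- `(re eʷ)² + (im eʷ)² = (e^{re w})²`. -/
private theorem expCurve_re_sq_add_im_sq (w : ℂ) :
    (Complex.exp w).re ^ 2 + (Complex.exp w).im ^ 2 = Real.exp w.re ^ 2 := by
  rw [← Complex.norm_exp, Complex.sq_norm, Complex.normSq_apply]
  ring

/-! ### The helper -/

/-- helper (frozen, D2): the exponential curve `G(w) = (re eʷ) e₀ + (im eʷ) J₀ e₀` in the first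
complex coordinate line of `ℝ⁴ = ℂ²` is `C^∞`, `J₀`-holomorphic (`DG_w (iζ) = J₀ (DG_w ζ)`), has
`∂ₓ G = G`, norm `‖G w‖ = e^{re w}`, coordinates `(G w)₀² + (G w)₁² = e^{2 re w}`,
`(G w)₂ = (G w)₃ = 0`, and is `2πi`-periodic. -/
theorem helper_frozen_expCurve : ContDiff ℝ ∞ (fun w : ℂ => (Complex.exp w).re • EuclideanSpace.single (0 : Fin 4) (1 : ℝ) + (Complex.exp w).im • Literature.Geometry.Symplectic.stdComplexStructure (EuclideanSpace.single (0 : Fin 4) (1 : ℝ))) ∧ (∀ w ζ : ℂ, fderiv ℝ (fun w : ℂ => (Complex.exp w).re • EuclideanSpace.single (0 : Fin 4) (1 : ℝ) + (Complex.exp w).im • Literature.Geometry.Symplectic.stdComplexStructure (EuclideanSpace.single (0 : Fin 4) (1 : ℝ))) w (Complex.I * ζ) = Literature.Geometry.Symplectic.stdComplexStructure (fderiv ℝ (fun w : ℂ => (Complex.exp w).re • EuclideanSpace.single (0 : Fin 4) (1 : ℝ) + (Complex.exp w).im • Literature.Geometry.Symplectic.stdComplexStructure (EuclideanSpace.single (0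 : Fin 4) (1 : ℝ))) w ζ)) ∧ (∀ w : ℂ, fderiv ℝ (fun w : ℂ => (Complex.exp w).re • EuclideanSpace.single (0 : Fin 4) (1 : ℝ) + (Complex.exp w).im • Literature.Geometry.Symplectic.stdComplexStructure (EuclideanSpace.single (0 : Fin 4) (1 : ℝ))) w 1 = (Complex.exp w).re • EuclideanSpace.single (0 : Fin 4) (1 : ℝ) + (Complex.exp w).im • Literature.Geometry.Symplectic.stdComplexStructure (EuclideanSpace.single (0 : Fin 4) (1 : ℝ))) ∧ (∀ w : ℂ, ‖(Complex.exp w).re • EuclideanSpace.single (0 : Fin 4) (1 : ℝ) + (Complex.exp w).im • Literature.Geometry.Symplectic.stdComplexStructure (EuclideanSpace.single (0 : Fin 4) (1 : ℝ))‖ = Real.exp w.re) ∧ (∀ w : ℂ, ((Complex.exp w).re • EuclideanSpace.single (0 : Fin 4) (1 : ℝ) + (Complex.exp w).im • Literature.Geometry.Symplectic.stdComplexStructure (EuclideanSpace.single (0 : Fin 4) (1 : ℝ))) 0 ^ 2 + ((Complex.exp w).re • EuclideanSpace.single (0 : Fin 4) (1 : ℝ) + (Complex.exp w).im • Literature.Geometry.Symplectic.stdComplexStructure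 (EuclideanSpace.single (0 : Fin 4) (1 : ℝ))) 1 ^ 2 = Real.exp w.re ^ 2 ∧ ((Complex.exp w).re • EuclideanSpace.single (0 : Fin 4) (1 : ℝ) + (Complex.exp w).im • Literature.Geometry.Symplectic.stdComplexStructure (EuclideanSpace.single (0 : Fin 4) (1 : ℝ))) 2 = 0 ∧ ((Complex.exp w).re • EuclideanSpace.single (0 : Fin 4) (1 : ℝ) + (Complex.exp w).im • Literature.Geometry.Symplectic.stdComplexStructure (EuclideanSpace.single (0 : Fin 4) (1 : ℝ))) 3 = 0) ∧ (∀ w : ℂ, (Complex.exp (w + 2 * π * Complex.I)).re • EuclideanSpace.single (0 : Fin 4) (1 : ℝ) + (Complex.exp (w + 2 * π * Complex.I)).im • Literature.Geometry.Symplectic.stdComplexStructure (EuclideanSpace.single (0 : Fin 4) (1 : ℝ)) = (Complex.exp w).re • EuclideanSpace.single (0 : Fin 4) (1 : ℝ) + (Complex.exp w).im • Literature.Geometry.Symplectic.stdComplexStructure (EuclideanSpace.single (0 : Fin 4) (1 : ℝ))) := by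
  refine ⟨expCurve_contDiff _, fun w ζ => ?_, fun w => ?_, fun w => ?_, fun w => ?_, fun w => ?_⟩
  · -- `J₀`-holomorphicity: `DG_w (iζ) = L (eʷ i ζ) = L (i (eʷ ζ)) = J₀ (L (eʷ ζ)) = J₀ (DG_w ζ)`
    rw [expCurve_fderiv, expCurve_fderiv, mul_left_comm, expCurve_line_I_mul]
  · -- `∂ₓ G = DG_w 1 = L (eʷ) = G w`
    rw [expCurve_fderiv, mul_one]
  · -- `‖G w‖ = e^{re w}`
    have h : ‖(Complex.exp w).re • EuclideanSpace.single (0 : Fin 4) (1 : ℝ) +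
        (Complex.exp w).im • stdComplexStructure (EuclideanSpace.single (0 : Fin 4) (1 : ℝ))‖ ^ 2 =
        Real.exp w.re ^ 2 := by
      rw [expCurve_norm_sq_smul_add_smul, PiLp.norm_single, norm_one, one_pow, mul_one,
        expCurve_re_sq_add_im_sq]
    exact (sq_eq_sq₀ (norm_nonneg _) (Real.exp_pos _).le).1 h
  · -- coordinates
    obtain ⟨h0, h1, h2, h3⟩ := expCurve_coords (Complex.exp w).re (Complex.exp w).im
    refine ⟨?_, h2, h3⟩
    rw [h0, h1, expCurve_re_sq_add_im_sq]
  · -- periodicity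
    rw [Complex.exp_periodic w]

end Summit.SmoothPoincare4.SmoothPoincare4.Theorems.HyperbolicEnd.Negative

end
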